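import Summits.QuantumFields.YangMills.Theorems.UnitScaleTiltProp8ChartCovariance
import Literature.MathematicalPhysics.QuantumFieldTheory.Balaban1983to89.B6SectAOperatorsV1
import HarnessLib

/-!
# Route `UnitScaleTilt`, crux K1 «MinimiserStabilityRegPr» (stmt-QuantumFields-19200), stub V2′ `stub_halvingStep` — pillar P3, DEFINITIONS FILE (candidate (R1) of
# ★★OWNER g26 RULING g26-№5): **PRINT'S DOUBLE-BAR CHART OF THE MULTI-LEVEL CONSTRAINT** ([Balaban1985Averaging] (89) `V̿(c) = v(c₋)⁻¹·V̄(c)·v(c₊)`, iterated as in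
# (127)∕(150), read in log coordinates as in [Balaban1985Variational] (20)∕(44): `Q_j(U₀, ηA) = (1∕i)·log(U̿^{(j)})`)

Cell `ym3-torus` (HUMAN RULING D-0037: YM₃ on the torus is ladder rung R3, not the Clay problem), width seat `ym-ust-19936-w8` gen 0.
`--supports stmt-QuantumFields-19200 --as helper`; definitions + flat-point values + the covariance bridge only; 0 sorry.

WHY.  The chart of record `Prop8Chart.chartLog` reads the SINGLE-bar (0.4) average `emlIterU`, which is exactly gauge covariant at the block centres
(✓`emlIterU_gaugeActT`); its linearisation carries the centre-stair coarse gauge `dΛ_j` (✓`ChartDeriv`) and its remainder has an un-suppressed per-bond kernel at the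
centre bonds (✓`ChartBasePointGaugeLine`, FINDING w8-1 ∕ ★w4-19200 g3 06:04Z, RULING g26-№4).  Print's variational coordinates ([Balaban1985Variational] Sect. A (18)–(21):
[Balaban1985RegularSpaces] Thm 2 Landau slice) carry the constraint through [Balaban1985Averaging] Prop. 4's functional, built on the DOUBLE-bar average (89): the single-bar
average conjugated at the two centres by the BLOCK FRAMES `v(y) = exp[mean log of the centre-stair transporters]`.  With the SAME `d!`-symmetrised stair family `Idx P` as
`emlAvgU`, the frames divide the comb means out EXACTLY at first order (`log V̿ = L·bondAvg + O(2)`, cf. ✓`linAvg_eq_bondAvg_sub_grad_combMean`), and absorb centre gauge maps.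
WHAT (this file).  `vframeU V y` — the frame `v(y) ∈ 𝔸ˣ` (an `eml`, a unit by `isUnit_eml`); `dbarAvgU V := (emlAvgU V)^{v⁻¹}` — (89) as the single-bar average
GAUGE-TRANSFORMED by the inverse frames at the coarse sites (`gaugeActT`, so every covariance lemma of ✓`Prop8ChartCovariance` applies by `rfl`); `dbarIterU k` — its `k`-fold
iterate (frames recomputed at every level from the previous double-bar level, [B7] (127)∕(150)); `chartLogFlat η D A (j,c) := −i·log(U̿^{(j)}(e^{iηA})(c))` — print's
`Q_j(U₀ = 1, ηA)` at the constraint index `(j,c)`, the (R1) twin of `chartLog`.  Proved: `coe_vframeU`, `vframeU_one`, `coe_dbarAvgU`, `dbarAvgU_one`, `dbarIterU_zero∕succ∕one`,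
`chartLogFlat_apply`, `chartLogFlat_zero` (the flat point is the origin), `dbarAvgU_eq_gaugeActT` ∕ `emlAvgU_gaugeActT_eq_dbarAvgU` (the bridge (89) to the single bar:
`U̿ = Ū(U^u)` for every fine `u` with `u ∘ emb = v⁻¹`, ✓`emlAvgU_gaugeActT`).
HONEST SCOPE.  Definitions and sanity only; NOT proved here: the linearisation `fderiv (chartLogFlat η D) 0 = η·Lʲ·bondAvgIter j` (target of the (R1) `ChartDeriv` twin),
`hCd∕hCq` ([B7] Props. 3–4), (73)∕(157) ([B7] Prop. 5), the [B8] Thm 2 slice.  NOT a claim about the stub, the crux, the rung or the mass gap.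

References: T. Bałaban, CMP **98** (1985) 17–51 [Balaban1985Averaging] (89) p.31, (110)–(112) p.34, (122)–(127) p.36, (134) p.38, (150) p.40; CMP **102** (1985)
277–309 [Balaban1985Variational] (18)–(21) pp.280–281, (44) p.285; CMP **99** (1985) 75–102 [Balaban1985RegularSpaces] Thm 2.
-/

set_option autoImplicit false

noncomputable section

open scoped BigOperators
open NormedSpace

namespace Summit.QuantumFields.YangMills.Theorems.Prop8ChartDoubleBar

open Literature.MathematicalPhysics.QuantumFieldTheory.Balaban1983to89
open T4Continuum BlockAveraging ExpMeanLog MatrixLog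
open B10Eq27TorusAxialLog (holT holT_nil holT_one gaugeActT gaugeActT_apply)
open Summit.QuantumFields.YangMills.Theorems.Prop8Chart (emlAvgU_gaugeActT)
open B6SectADomainsV1 (Domains)
open B6SectAOperatorsV1 (BondIdx)
open Summit.QuantumFields.YangMills.Theorems.Prop8Chart (expCfg expCfg_zero emlAvgU emlAvgU_one eml_const_one)

variable {P : Params} {𝔸 : Type*} [NormedRing 𝔸] [NormedAlgebra ℂ 𝔸] [CompleteSpace 𝔸]

/-! ## §1 The block frames -/

section Frame

variable {j : ℕ}

/-- **THE BLOCK FRAME** `v(y) = exp[|I|⁻¹ Σ_i log U(Γ_{y,x_i})]` ∈ 𝔸ˣ: the `exp[mean log]` of the centre-stair transporters of the block of the coarse site `y`, over the SAME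
symmetrised index family `Idx P` (offsets × stair orders) as the (0.4) loops of `emlAvgU` (the second stair order of the index is idle here).
[cite: Balaban1985Averaging, (110) p.34, (89) p.31] -/
def vframeU (U : GaugeField P j 𝔸ˣ) (y : Site P (j + 1)) : 𝔸ˣ :=
  (isUnit_eml (fun i : Idx P => ((holT U (emb y) (stairWord i.2.1 (off i.1)) : 𝔸ˣ) : 𝔸))).unit

/-- the value of the frame. [cite: Balaban1985Averaging, (110) p.34] -/
theorem coe_vframeU (U : GaugeField P j 𝔸ˣ) (y : Site P (j + 1)) :
    ((vframeU U y : 𝔸ˣ) : 𝔸) = eml (fun i : Idx P => ((holT U (emb y) (stairWord i.2.1 (off i.1)) : 𝔸ˣ) : 𝔸)) := by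
  rw [vframeU, IsUnit.unit_spec]

/-- the frames of the flat field are trivial. [cite: Balaban1985Averaging, (110) p.34] -/
@[simp] theorem vframeU_one (y : Site P (j + 1)) : vframeU (fun _ : PBond P j => (1 : 𝔸ˣ)) y = 1 := by
  apply Units.ext
  rw [coe_vframeU, Units.val_one]
  have h1 : (fun i : Idx P => ((holT (fun _ : PBond P j => (1 : 𝔸ˣ)) (emb y) (stairWord i.2.1 (off i.1)) : 𝔸ˣ) : 𝔸)) = fun _ => 1 := by
    funext i; rw [holT_one]; rfl
  rw [h1, eml_const_one]

end Frame

/-! ## §2 The double-bar average and its iterate -/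

section Avg

variable {j : ℕ}

/-- **THE DOUBLE-BAR (89) AVERAGE** `U̿(c) = v(c₋)⁻¹·Ū(c)·v(c₊)`: the unguarded single-bar (0.4) average `emlAvgU` gauge-transformed at the coarse sites by the inverse
frames. [cite: Balaban1985Averaging, (89) p.31, (120) p.35] -/
def dbarAvgU (U : GaugeField P j 𝔸ˣ) : GaugeField P (j + 1) 𝔸ˣ := fun c =>
  (vframeU U c.src)⁻¹ * emlAvgU U c * vframeU U c.tgt

/-- (89) unfolded at a coarse bond. [cite: Balaban1985Averaging, (89) p.31] -/
theorem dbarAvgU_apply (U : GaugeField P j 𝔸ˣ) (c : PBond P (j + 1)) :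
    dbarAvgU U c = (vframeU U c.src)⁻¹ * emlAvgU U c * vframeU U c.tgt := rfl

/-- **THE BRIDGE TO THE SINGLE BAR**: `U̿ = (Ū)^{v⁻¹}` — the double-bar average is the single-bar average GAUGE-TRANSFORMED at the coarse sites by the inverse frames
(so every covariance lemma of ✓`Prop8ChartCovariance` applies). [cite: Balaban1985Averaging, (11) p.19, (89) p.31] -/
theorem dbarAvgU_eq_gaugeActT (U : GaugeField P j 𝔸ˣ) :
    dbarAvgU U = gaugeActT (fun y : Site P (j + 1) => (vframeU U y)⁻¹) (emlAvgU U) := by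
  funext c
  rw [dbarAvgU_apply, gaugeActT_apply, inv_inv]

/-- **(89) AS A FINE GAUGE TRANSFORMATION**: for every fine gauge map `u` that equals the inverse frame at the block centres, `u(emb y) = v(y)⁻¹`, the single-bar average
of `U^u` IS the double-bar average of `U` (✓`emlAvgU_gaugeActT`). [cite: Balaban1985Averaging, (11) p.19, (89)/(110) pp.31-34] -/
theorem emlAvgU_gaugeActT_eq_dbarAvgU (U : GaugeField P j 𝔸ˣ) (u : GaugeTransf P j 𝔸ˣ) (hu : ∀ y : Site P (j + 1), u (emb y) = (vframeU U y)⁻¹) :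
    emlAvgU (gaugeActT u U) = dbarAvgU U := by
  rw [Prop8Chart.emlAvgU_gaugeActT, dbarAvgU_eq_gaugeActT]
  congr 1
  funext y
  exact hu y

/-- the value of the double-bar bond variable. [cite: Balaban1985Averaging, (89) p.31] -/
theorem coe_dbarAvgU (U : GaugeField P j 𝔸ˣ) (c : PBond P (j + 1)) :
    ((dbarAvgU U c : 𝔸ˣ) : 𝔸) = (((vframeU U c.src)⁻¹ : 𝔸ˣ) : 𝔸) * ((emlAvgU U c : 𝔸ˣ) : 𝔸) * ((vframeU U c.tgt : 𝔸ˣ) : 𝔸) := by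
  rw [dbarAvgU_apply, Units.val_mul, Units.val_mul]

/-- the flat field double-bar-averages to the flat field. [cite: Balaban1985Averaging, (89) p.31] -/
@[simp] theorem dbarAvgU_one : dbarAvgU (P := P) (j := j) (fun _ : PBond P j => (1 : 𝔸ˣ)) = fun _ => 1 := by
  funext c
  rw [dbarAvgU_apply, emlAvgU_one, vframeU_one, vframeU_one, inv_one, one_mul, one_mul]

end Avg

/-- **THE `k`-FOLD DOUBLE-BAR AVERAGE** `U̿^{(k)}` — frames recomputed at every level from the previous double-bar level ([B7] (127)∕(150):
`Q_{j+1}(U₀, ηA) = Q(Ū₀ʲ, Q_j(U₀, ηA))`). [cite: Balaban1985Averaging, (127) p.36, (150) p.40] -/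
def dbarIterU : (k : ℕ) → GaugeField P 0 𝔸ˣ → GaugeField P k 𝔸ˣ
  | 0 => fun U => U
  | k + 1 => fun U => dbarAvgU (dbarIterU k U)

/-- no averaging. [cite: Balaban1985Averaging, (127) p.36] -/
@[simp] theorem dbarIterU_zero (U : GaugeField P 0 𝔸ˣ) : dbarIterU 0 U = U := rfl

/-- one more level. [cite: Balaban1985Averaging, (127) p.36] -/
theorem dbarIterU_succ (k : ℕ) (U : GaugeField P 0 𝔸ˣ) : dbarIterU (k + 1) U = dbarAvgU (dbarIterU k U) := rfl

/-- the flat field stays flat at every level. [cite: Balaban1985Averaging, (127) p.36] -/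
@[simp] theorem dbarIterU_one : ∀ k : ℕ, dbarIterU (P := P) k (fun _ : PBond P 0 => (1 : 𝔸ˣ)) = fun _ => 1
  | 0 => rfl
  | k + 1 => by rw [dbarIterU_succ, dbarIterU_one k, dbarAvgU_one]

/-! ## §3 The double-bar chart at the constraint indices -/

/-- **PRINT'S MULTI-LEVEL CONSTRAINT MAP IN THE LOGARITHMIC CHART AT BACKGROUND 1** — the (R1) twin of `Prop8Chart.chartLog`:
`Q♭(A)(j, c) := −i·log(U̿^{(j)}(e^{iηA})(c))` at every constraint index `(j, c)` of the nested family `D` ([Balaban1985Variational] (20)∕(44) with [B7] Prop. 4's functional).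
[cite: Balaban1985Variational, (20) p.281, (44) p.285; Balaban1985Averaging, (134) p.38] -/
def chartLogFlat (η : ℝ) (D : Domains P) (A : PBond P 0 → 𝔸) : BondIdx D → 𝔸 := fun i =>
  (-Complex.I) • mlog (((dbarIterU (i.1.1 : ℕ) (expCfg η A)) i.1.2 : 𝔸ˣ) : 𝔸)

/-- `chartLogFlat` unfolded at an index. [cite: Balaban1985Variational, (20) p.281] -/
theorem chartLogFlat_apply (η : ℝ) (D : Domains P) (A : PBond P 0 → 𝔸) (i : BondIdx D) :
    chartLogFlat η D A i = (-Complex.I) • mlog (((dbarIterU (i.1.1 : ℕ) (expCfg η A)) i.1.2 : 𝔸ˣ) : 𝔸) := rfl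

/-- the flat point is the origin of the double-bar chart: `Q♭(0) = 0`. [cite: Balaban1985Variational, (20) p.281] -/
@[simp] theorem chartLogFlat_zero (η : ℝ) (D : Domains P) : chartLogFlat η D (0 : PBond P 0 → 𝔸) = 0 := by
  funext i
  rw [chartLogFlat_apply, expCfg_zero, dbarIterU_one, Pi.zero_apply, Units.val_one, mlog_one, smul_zero]

end Summit.QuantumFields.YangMills.Theorems.Prop8ChartDoubleBar

end
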